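import Literature.AnabelianGeometry.EtaleTheta.Discharge.Sec5ThetaSubquotientProjCriterion
import Literature.AnabelianGeometry.SemiGraphs.Temperoids
import HarnessLib

/-!
# [EtTh] §5 p.327: the subquotient record `(l·Δ_Θ)_E ↞ P_E ⊆ Aut_D(E)` with surjectivity AT GALOIS OBJECTS ONLY
# (`ThetaSubquotientProjGalois`, v2 of abc-iut-L2-t4's `ThetaSubquotientProj`; additive file, zero edit to the frozen record)

S. Mochizuki, *The étale theta function and its Frobenioid-theoretic manifestations*, Publ. RIMS **45** (2009), §5 p. 327
(PDF p. 101): "for `D ∈ Ob(D)`, these subquotients [`Π^tp_X ↠ (Π^tp_X)^Θ ⊇ l·Δ_Θ`] determine subquotients `Aut_D(D) ↠ Aut^Θ_D(D)`;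
`(l·Δ_Θ)_D ⊆ Aut^Θ_D(D)`" [cite: MochizukiEtTh2009, §5 p.327 (PDF p.101)]; Prop. 5.1 / Lemma 5.9 p. 332 (PDF p. 106): the projective
systems of §5 run over (connected) GALOIS coverings; [SemiAnbd] Def. 3.1 (iv) p. 33 ("Galois object") [cite: MochizukiSemiAnbd2006, Def 3.1(iv) p.33].

abc-iut cell, layer L2, seat abc-iut-w6-d079 (gen 6), row «PROJ-SURJ-PLAN-A» (abc-iut-L2-lead gen 6, R789/R847; GAP-LEDGER G-w4d042g3-1
plan (a); VNEXT census item B1).  WHY: abc-iut-L2-t4's frozen record `FrobenioidCyclotomicRigidity.ThetaSubquotientProj 𝔉`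
(`FrobenioidCyclotomicRigidity.lean` l.97–103) asks `proj E : pre E →* 𝔉.lDelta E` to be SURJECTIVE at EVERY object `E` of the base; at
abc-iut-L2-t9's R2 carrier over `B^temp(Π)⁰` that fails at RIGID non-Galois objects (abc-iut-w5-d029 `Sec5ThetaSubquotientProjCriterion`,
abc-iut-L2-t9 p456572 `…EmptyOfRigidObject`, and the kernel certificate p476337 `…EmptyAtRootModel`: the record is EMPTY at the root model
`ThetaSetting.model p` for `l` odd), so every theorem binding `(P : ThetaSubquotientProj 𝔉)` there quantifies over an empty type.  Print
only ever evaluates `(l·Δ_Θ)_(−)` along Galois coverings.  THIS FILE (class (b): ONE new structure + its bookkeeping; nothing landed is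
edited or restated) records the v2 shape asked for by the row:

* `ThetaSubquotientProjGalois 𝔉 Gal` — fields `pre` / `proj` VERBATIM as in v1, and `proj_surjective : ∀ E, Gal E → Surjective (proj E)`
  for an explicit predicate `Gal : D → Prop` of "Galois objects".  For an abstract base `D` the intended reading is [SemiAnbd] Def. 3.1 (iv)
  `Gal := IsGaloisObj`; for `D = B^temp(Π)⁰ = ConnectedPart (BTemp Π)` the reading of every §4/§5 file of the cell is
  `Gal := fun E => IsGaloisObj E.obj` (Galois in `B^temp(Π)`; e.g. `galoisSurjOf_connectedPart_surjective`, `BiKummerDef22Context`) — the two are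
  not identified here (the §0 `IsConnectedObj` clause of `IsGaloisObj` read INSIDE the full subcategory is a different proposition), which is why
  the predicate is a parameter;
* `ThetaSubquotientProj.toGalois` (the forgetful map v1 → v2, any `Gal`), `ThetaSubquotientProjGalois.mono` (shrinking `Gal`),
  `ThetaSubquotientProjGalois.toProj` / `nonempty_top_iff` (`Gal := ⊤` recovers v1 both ways);
* `ThetaSubquotientProjGalois.IsKummerDetermined` — the v2 twin of abc-iut-L2-t4's Prop. 5.5 clause `IsKummerDetermined` (l.112–118: it
  reads `P` only through `pre`/`proj` at `Base(B_N)`), the SAME formula on the v2 record, with `isKummerDetermined_toGalois_iff : … ↔ v1`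
  (`Iff.rfl`) — so that consumer heads can be re-keyed by a binder-type change;
* the v2 forms of abc-iut-w5-d029's criterion lemmas: `nonempty_of_surjective_on` (producer), `exists_surjective_of_subgroup_aut` /
  `subsingleton_lDelta_of_subsingleton_aut` (necessary condition, now only AT `Gal` objects: a rigid GALOIS object must have trivial carrier —
  rigid non-Galois objects no longer obstruct).

Inhabitation at the genuine R2 carrier (every `𝔉` over `B^temp(Π)⁰` with `𝔉.toThetaSubquotientStub = thetaSubquotientStub q ι`, `q` onto —
in particular abc-iut-L2-t1's root model, where v1 is empty) is the proof-only sequel `Discharge/Sec5ThetaSubquotientProjGaloisInhabited.lean`.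
HONEST FRAMING: a typing repair of the cell's OWN record (weaker quantifier, as print uses it); nothing of [EtTh] (refereed) is asserted;
no side is taken on [IUTchIII] Cor. 3.12; typed ≠ proved.
-/

namespace Literature.AnabelianGeometry.EtaleTheta

namespace FrobenioidCyclotomicRigidity

open CategoryTheory

universe w v v' u u'

variable {C : Type u} [Category.{v} C] {D : Type u'} [Category.{v'} D]

/-- **v2 of the §5 subquotient record** (p.327 (PDF p.101): "these subquotients determine subquotients `Aut_D(D) ↠ Aut^Θ_D(D)`;
`(l·Δ_Θ)_D ⊆ Aut^Θ_D(D)`"): for each `E ∈ Ob(D)` the preimage `P_E ⊆ Aut_D(E)` of `(l·Δ_Θ)_E` and the projection `P_E → (l·Δ_Θ)_E`,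
required to be ONTO only at the objects singled out by `Gal` (print: the connected Galois coverings along which Prop. 5.1 / Lemma 5.9
take their projective limits).  `Gal := IsGaloisObj` for an abstract base; `Gal := fun E => IsGaloisObj E.obj` over `B^temp(Π)⁰`.
[cite: MochizukiEtTh2009, §5 p.327 (PDF p.101)] -/
structure ThetaSubquotientProjGalois (𝔉 : ThetaFrobenioid.{w} C D) (Gal : D → Prop) where
  /-- the preimage of `(l·Δ_Θ)_E ⊆ Aut^Θ_D(E)` in `Aut_D(E)` -/
  pre : ∀ E : D, Subgroup (Aut E)
  /-- the projection onto the subquotient `(l·Δ_Θ)_E` -/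
  proj : ∀ E : D, pre E →* 𝔉.lDelta E
  /-- it is surjective AT GALOIS OBJECTS (a subquotient of `Aut_D(E)` there) -/
  proj_surjective : ∀ E, Gal E → Function.Surjective (proj E)

variable {𝔉 : ThetaFrobenioid.{w} C D}

namespace ThetaSubquotientProj

/-- **The forgetful map v1 → v2**: a record surjective at every object is surjective at the `Gal` objects.
[cite: MochizukiEtTh2009, §5 p.327 (PDF p.101)] -/
def toGalois (Gal : D → Prop) (P : ThetaSubquotientProj 𝔉) : ThetaSubquotientProjGalois 𝔉 Gal where
  pre := P.pre
  proj := P.proj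
  proj_surjective E _ := P.proj_surjective E

/-- `toGalois` keeps `pre`. [cite: MochizukiEtTh2009, §5 p.327 (PDF p.101)] -/
@[simp] theorem toGalois_pre (Gal : D → Prop) (P : ThetaSubquotientProj 𝔉) : (P.toGalois Gal).pre = P.pre := rfl

/-- `toGalois` keeps `proj`. [cite: MochizukiEtTh2009, §5 p.327 (PDF p.101)] -/
@[simp] theorem toGalois_proj (Gal : D → Prop) (P : ThetaSubquotientProj 𝔉) : (P.toGalois Gal).proj = P.proj := rfl

end ThetaSubquotientProj

namespace ThetaSubquotientProjGalois

variable {Gal Gal' : D → Prop}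

/-- Shrinking the class of objects at which surjectivity is demanded. [cite: MochizukiEtTh2009, §5 p.327 (PDF p.101)] -/
def mono (h : ∀ E, Gal' E → Gal E) (P : ThetaSubquotientProjGalois 𝔉 Gal) : ThetaSubquotientProjGalois 𝔉 Gal' where
  pre := P.pre
  proj := P.proj
  proj_surjective E hE := P.proj_surjective E (h E hE)

/-- `mono` keeps `pre`. [cite: MochizukiEtTh2009, §5 p.327 (PDF p.101)] -/
@[simp] theorem mono_pre (h : ∀ E, Gal' E → Gal E) (P : ThetaSubquotientProjGalois 𝔉 Gal) : (P.mono h).pre = P.pre := rfl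

/-- `mono` keeps `proj`. [cite: MochizukiEtTh2009, §5 p.327 (PDF p.101)] -/
@[simp] theorem mono_proj (h : ∀ E, Gal' E → Gal E) (P : ThetaSubquotientProjGalois 𝔉 Gal) : (P.mono h).proj = P.proj := rfl

/-- With `Gal := ⊤` the v2 record IS the v1 record (back direction). [cite: MochizukiEtTh2009, §5 p.327 (PDF p.101)] -/
def toProj (P : ThetaSubquotientProjGalois 𝔉 fun _ => True) : ThetaSubquotientProj 𝔉 where
  pre := P.pre
  proj := P.proj
  proj_surjective E := P.proj_surjective E trivial

/-- `Gal := ⊤`: v2 is inhabited iff v1 is. [cite: MochizukiEtTh2009, §5 p.327 (PDF p.101)] -/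
theorem nonempty_top_iff :
    Nonempty (ThetaSubquotientProjGalois 𝔉 fun _ => True) ↔ Nonempty (ThetaSubquotientProj 𝔉) :=
  ⟨fun ⟨P⟩ => ⟨P.toProj⟩, fun ⟨P⟩ => ⟨P.toGalois _⟩⟩

/-- Every v1 inhabitant gives a v2 inhabitant, for every `Gal`. [cite: MochizukiEtTh2009, §5 p.327 (PDF p.101)] -/
theorem nonempty_of_nonempty_proj (Gal : D → Prop) (h : Nonempty (ThetaSubquotientProj 𝔉)) :
    Nonempty (ThetaSubquotientProjGalois 𝔉 Gal) :=
  h.map (ThetaSubquotientProj.toGalois Gal)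

/-! ### Producers and the necessary condition (v2 forms of abc-iut-w5-d029's criterion) -/

/-- **Producer**: subgroups `pre E ≤ Aut_D(E)` with homomorphisms to `(l·Δ_Θ)_E` that are onto at the `Gal` objects inhabit the
record (this is just the constructor, recorded for symmetry with `ThetaSubquotientProj.nonempty_of_surjective`).
[cite: MochizukiEtTh2009, §5 p.327 (PDF p.101)] -/
theorem nonempty_of_surjective_on (pre : ∀ E : D, Subgroup (Aut E)) (f : ∀ E : D, pre E →* 𝔉.lDelta E)
    (hf : ∀ E, Gal E → Function.Surjective (f E)) : Nonempty (ThetaSubquotientProjGalois 𝔉 Gal) :=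
  ⟨{ pre := pre, proj := f, proj_surjective := hf }⟩

/-- **Producer** from homomorphisms on the whole `Aut_D(E)` onto at `Gal` objects (`pre := ⊤`).
[cite: MochizukiEtTh2009, §5 p.327 (PDF p.101)] -/
theorem nonempty_of_surjective_aut (f : ∀ E : D, Aut E →* 𝔉.lDelta E)
    (hf : ∀ E, Gal E → Function.Surjective (f E)) : Nonempty (ThetaSubquotientProjGalois 𝔉 Gal) :=
  ⟨{ pre := fun _ => ⊤
     proj := fun E => (f E).comp (Subgroup.subtype ⊤)
     proj_surjective := fun E hE y => by
       obtain ⟨x, rfl⟩ := hf E hE y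
       exact ⟨⟨x, Subgroup.mem_top x⟩, rfl⟩ }⟩

/-- If every `Gal` object has trivial `(l·Δ_Θ)_E` the record is inhabited (`pre := ⊥`, `proj := 1`).
[cite: MochizukiEtTh2009, §5 p.327 (PDF p.101)] -/
theorem nonempty_of_subsingleton (h : ∀ E : D, Gal E → Subsingleton (𝔉.lDelta E)) :
    Nonempty (ThetaSubquotientProjGalois 𝔉 Gal) :=
  ⟨{ pre := fun _ => ⊥
     proj := fun _ => 1
     proj_surjective := fun E hE _ => ⟨1, (h E hE).elim _ _⟩ }⟩

/-- **Necessary condition, AT A `Gal` OBJECT**: `(l·Δ_Θ)_E` is a homomorphic image of a subgroup of `Aut_D(E)`.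
[cite: MochizukiEtTh2009, §5 p.327 (PDF p.101)] -/
theorem exists_surjective_of_subgroup_aut (P : ThetaSubquotientProjGalois 𝔉 Gal) (E : D) (hE : Gal E) :
    ∃ (H : Subgroup (Aut E)) (f : H →* 𝔉.lDelta E), Function.Surjective f :=
  ⟨P.pre E, P.proj E, P.proj_surjective E hE⟩

/-- Hence a RIGID `Gal` object (`Aut_D(E)` trivial) has trivial `(l·Δ_Θ)_E` under any v2 record; rigid NON-`Gal` objects (the obstruction
to v1 at the genuine carrier, abc-iut-L2-t9 p456572) no longer matter. [cite: MochizukiEtTh2009, §5 p.327 (PDF p.101)] -/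
theorem subsingleton_lDelta_of_subsingleton_aut (P : ThetaSubquotientProjGalois 𝔉 Gal) (E : D) (hE : Gal E)
    [Subsingleton (Aut E)] : Subsingleton (𝔉.lDelta E) := by
  refine ⟨fun a b => ?_⟩
  obtain ⟨x, rfl⟩ := P.proj_surjective E hE a
  obtain ⟨y, rfl⟩ := P.proj_surjective E hE b
  rw [Subsingleton.elim x y]

/-! ### The Prop. 5.5 clause on the v2 record -/

/-- Prop. 5.5, clause "the second Kummer class of Proposition 5.2, (iii), determines an isomorphism", read on the v2 record — abc-iut-L2-t4's
`IsKummerDetermined` (l.112–118) VERBATIM with `P : ThetaSubquotientProjGalois 𝔉 Gal` (that clause reads `P` only through `pre`/`proj` at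
`Base(B_N)`): on `B_N`, `ρ_{B_N}` is read off from the bi-Kummer difference `h ↦ s^⊓-gp_N(h) · s^⊔-gp_N(h)⁻¹` on the part of `H_{B_N}` lying
over `(l·Δ_Θ)_{B_N}`. [cite: MochizukiEtTh2009, Prop 5.5 p.327 (PDF p.101)] -/
def IsKummerDetermined (P : ThetaSubquotientProjGalois 𝔉 Gal) (ρ : RigidityFamily 𝔉)
    (hB : 𝔉.IsThetaSaturated 𝔉.BN) : Prop :=
  ∀ (h : 𝔉.HB) (hh : (h : Aut (𝔉.base.obj 𝔉.BN)) ∈ P.pre (𝔉.base.obj 𝔉.BN)),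
    (ρ 𝔉.BN hB (QuotientGroup.mk (P.proj _ ⟨h, hh⟩)) : Aut 𝔉.BN) =
      𝔉.sgpCap (h : Aut (𝔉.base.obj 𝔉.BN)) * (𝔉.sgpCup h)⁻¹

/-- The v2 clause on a forgotten v1 record IS the v1 clause (`Iff.rfl`): re-keying a consumer of `IsKummerDetermined 𝔉 P ρ hB` to the v2
record is a binder-type change. [cite: MochizukiEtTh2009, Prop 5.5 p.327 (PDF p.101)] -/
theorem isKummerDetermined_toGalois_iff (Gal : D → Prop) (P : ThetaSubquotientProj 𝔉) (ρ : RigidityFamily 𝔉)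
    (hB : 𝔉.IsThetaSaturated 𝔉.BN) :
    (P.toGalois Gal).IsKummerDetermined ρ hB ↔ FrobenioidCyclotomicRigidity.IsKummerDetermined 𝔉 P ρ hB :=
  Iff.rfl

/-- The clause is insensitive to `mono`. [cite: MochizukiEtTh2009, Prop 5.5 p.327 (PDF p.101)] -/
theorem isKummerDetermined_mono_iff (h : ∀ E, Gal' E → Gal E) (P : ThetaSubquotientProjGalois 𝔉 Gal)
    (ρ : RigidityFamily 𝔉) (hB : 𝔉.IsThetaSaturated 𝔉.BN) :
    (P.mono h).IsKummerDetermined ρ hB ↔ P.IsKummerDetermined ρ hB :=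
  Iff.rfl

end ThetaSubquotientProjGalois

end FrobenioidCyclotomicRigidity

end Literature.AnabelianGeometry.EtaleTheta
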